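import Literature.Geometry.Kaehler.HolomorphicLineBundleCechFinite
import Literature.Geometry.Kaehler.HolomorphicLineBundleCechLerayData
import HarnessLib

/-!
# Refinement of framed covers: `H¹(𝔚, 𝒪(L)) → H¹(𝔘, 𝒪(L))` is injective, and `dim H¹(𝔚, 𝒪(L)) < ∞` on compact manifolds

Layer `Literature/Geometry/Kaehler`. For the sheaf `𝒪(L)` of sections of a cocycle line bundle
(`HolomorphicLineBundleCech`) and two framed covers `𝔚 = (W_i, frame i)`, `𝔘 = (U_k, frame' k)` of `M`
with a REFINEMENT MAP `r` (`U_k ⊆ W_{r k}`; the frames need not be related):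

* `FramedCover.refineMap` — the refinement cochain map `C^•(𝔚, 𝒪(L)) → C^•(𝔘, 𝒪(L))`,
  `(ρ c)_J = g_{frame (r (J 0)), frame' (J 0)} · c_{r ∘ J} |_{U_J}` (restrict and convert to the frames
  of `𝔘`), commuting with the Čech differentials (`refineMap_delta`), and the induced map
  `FramedCover.refineH` on cohomology;
* **`FramedCover.exists_delta_eq_of_refineMap_eq_delta`** — the classical injectivity lemma in
  degree one (J.-P. Serre, FAC n° 22, Prop. 3; O. Forster, *Lectures on Riemann Surfaces*, Lemma 12.4 /
  §12.3): if the refinement of a `1`-cocycle `c` of `𝔚` is a coboundary `δ b` on a COVERING `𝔘`, then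
  `c = δ h` already on `𝔚`, with `h_i = g_{frame' k, frame i} b_k - c_{(i, r k)}` on `W_i ∩ U_k`
  (independent of `k` by the two cocycle identities; glued over `k`, holomorphic locally);
  `FramedCover.injective_refineH_one`;
* **`FramedCover.finite_cohomology_one`** — consequently, on a COMPACT complex manifold,
  `H¹(𝔚, 𝒪(L))` is finite-dimensional for EVERY covering framed cover `𝔚` of `L`: it injects into the
  finite-dimensional `H¹` of the level-`0` cover of nested Leray data subordinate to `L` and to `𝔚`
  (`HolomorphicLineBundle.exists_finite_cohomology_one`, the twisted Cartan–Serre theorem).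

Everything is proved; the definitions are `refineMap`, `refineH` and the gluing `refineGlue`.

## References

* J.-P. Serre, *Faisceaux algébriques cohérents* (1955), n° 21–22 (refinements; Prop. 3: injectivity
  on `H¹`). [SerreFAC1955]
* O. Forster, *Lectures on Riemann Surfaces* (1981), §12 (Lemma 12.4, Def. 12.5). [Forster1981]
* H. Cartan, J.-P. Serre, C. R. Acad. Sci. Paris 237 (1953) 128–130. [CartanSerre1953]
-/

noncomputable section

open scoped Manifold ContDiff Topology
open Set Filter Function Literature.Algebra.Homology Literature.Geometry.Manifold

namespace Literature.Geometry.Kaehler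

section Existence

variable {ι : Type*} {E : Type*} [NormedAddCommGroup E] [NormedSpace ℂ E]
  {M : Type*} [TopologicalSpace M] [ChartedSpace E M]

/-- **`dim H¹(𝔘, 𝒪(L)) < ∞` on a compact complex manifold, existence form.** For every holomorphic
line cocycle `L` on a compact (Hausdorff) complex manifold and every auxiliary assignment `𝒲` of open
neighbourhoods there are nested Leray data `D` subordinate to the trivialisation of `L` and to `𝒲`
(`HolomorphicLineBundle.exists_dolbeaultLerayDatum_subordinate`) — four nested finite covers of `M`
by `∂̄`-acyclic chart-convex sets — whose level-`0` cover has FINITE-DIMENSIONAL first Čech cohomology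
with coefficients in the sheaf of sections of `L` (Cartan–Serre (1953); Grauert–Remmert (1977),
Kap. VI §4). [cite: CartanSerre1953] -/
theorem HolomorphicLineBundle.exists_finite_cohomology_one [FiniteDimensional ℂ E] [T2Space M] [CompactSpace M]
    [IsManifold 𝓘(ℂ, E) ω M] [IsManifold 𝓘(ℝ, E) ∞ M] (L : HolomorphicLineBundle ι E M) (𝒲 : OpenNhdFamily M) :
    ∃ (D : DolbeaultLerayDatum E M) (fr : ↥D.s → ι) (hfr : ∀ i, D.U 3 i ⊆ L.baseSet (fr i)),
      (∀ i, ∃ x, D.U 3 i ⊆ 𝒲.V x) ∧ Module.Finite ℂ ((D.framedCover fr hfr 0).cohomology 1) := by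
  obtain ⟨D, fr, hfr, hW⟩ := L.exists_dolbeaultLerayDatum_subordinate 𝒲
  exact ⟨D, fr, hfr, hW, D.finite_cohomology_oneL fr hfr⟩

end Existence

namespace HolomorphicLineBundle

namespace FramedCover

variable {ι κ κ' : Type*} {E : Type*} [NormedAddCommGroup E] [NormedSpace ℂ E]
  {M : Type*} [TopologicalSpace M] [ChartedSpace E M]
  {L : HolomorphicLineBundle ι E M} (W : L.FramedCover κ') (U : L.FramedCover κ)
  (r : κ → κ') (hr : ∀ k, U.U k ⊆ W.U (r k))

/-! ### The refinement cochain map -/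

include hr in
/-- A finite intersection of the fine cover lies in the corresponding one of the coarse cover.
[folklore] -/
theorem cechSet_subset_cechSet_comp {n : ℕ} (J : Fin n → κ) : cechSet U.U J ⊆ cechSet W.U (r ∘ J) :=
  fun _ hx ↦ mem_cechSet_iff.2 fun k ↦ hr _ (mem_cechSet_iff.1 hx k)

include hr in
/-- The change of frame from the coarse to the fine cover is holomorphic on `U_J`. [folklore] -/
theorem mdifferentiableOn_coordChange_refine {a : ℕ} (J : Fin (a + 1) → κ) :
    MDifferentiableOn 𝓘(ℂ, E) 𝓘(ℂ, ℂ) (L.coordChange (W.frame (r (J 0))) (U.frame (J 0))) (cechSet U.U J) :=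
  (L.mdifferentiableOn_coordChange _ _).mono fun _ hx ↦
    ⟨W.subset _ (hr _ (cechSet_subset_apply U.U J 0 hx)), U.cechSet_subset_baseSet J 0 hx⟩

/-- **The refinement cochain map** `C^a(𝔚, 𝒪(L)) → C^a(𝔘, 𝒪(L))`: restrict `c_{r ∘ J}` to `U_J` and
convert it from the frame of `W_{r (J 0)}` to the frame of `U_{J 0}` (Serre FAC n° 21, `τ*`).
[cite: SerreFAC1955, n° 21] -/
def refineMap (a : ℕ) : W.Cochain a →ₗ[ℂ] U.Cochain a :=
  LinearMap.pi fun J ↦ holFunOn.mulRestrict (E := E) (W.cechSet_subset_cechSet_comp U r hr J)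
    (W.mdifferentiableOn_coordChange_refine U r hr J) ∘ₗ LinearMap.proj (r ∘ J)

/-- The refinement map at a point of `U_J`. [folklore] -/
theorem refineMap_apply_apply_of_mem {a : ℕ} (c : W.Cochain a) {J : Fin (a + 1) → κ} {x : M}
    (hx : x ∈ cechSet U.U J) :
    (W.refineMap U r hr a c J : M → ℂ) x = L.coordChange (W.frame (r (J 0))) (U.frame (J 0)) x * (c (r ∘ J) : M → ℂ) x :=
  holFunOn.mulRestrict_apply_of_mem (W.cechSet_subset_cechSet_comp U r hr J)
    (W.mdifferentiableOn_coordChange_refine U r hr J) (c (r ∘ J)) hx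

/-- **The refinement map is a cochain map.** [cite: SerreFAC1955, n° 21] -/
theorem refineMap_delta (a : ℕ) (c : W.Cochain a) :
    W.refineMap U r hr (a + 1) (W.delta a c) = U.delta a (W.refineMap U r hr a c) := by
  funext J
  refine Subtype.ext (funext fun x ↦ ?_)
  by_cases hx : x ∈ cechSet U.U J
  · have hxW : x ∈ cechSet W.U (r ∘ J) := W.cechSet_subset_cechSet_comp U r hr J hx
    rw [W.refineMap_apply_apply_of_mem U r hr _ hx, W.delta_apply_apply_of_mem c hxW,
      U.delta_apply_apply_of_mem _ hx, Finset.mul_sum]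
    refine Finset.sum_congr rfl fun j _ ↦ ?_
    have hxj : x ∈ cechSet U.U (J ∘ Fin.succAbove j) := cechSet_subset_comp U.U J _ hx
    rw [W.refineMap_apply_apply_of_mem U r hr c hxj]
    -- the four frames at `x`
    have h1 : x ∈ L.baseSet (W.frame (r (J (Fin.succAbove j 0)))) :=
      W.subset _ (hr _ (cechSet_subset_apply U.U J _ hx))
    have h2 : x ∈ L.baseSet (W.frame (r (J 0))) := W.subset _ (hr _ (cechSet_subset_apply U.U J 0 hx))
    have h3 : x ∈ L.baseSet (U.frame (J (Fin.succAbove j 0))) := U.cechSet_subset_baseSet J _ hx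
    have h4 : x ∈ L.baseSet (U.frame (J 0)) := U.cechSet_subset_baseSet J 0 hx
    have key : L.coordChange (W.frame (r (J 0))) (U.frame (J 0)) x *
        W.trans (r ∘ J) (Fin.succAbove j) x =
        U.trans J (Fin.succAbove j) x *
          L.coordChange (W.frame (r (J (Fin.succAbove j 0)))) (U.frame (J (Fin.succAbove j 0))) x := by
      unfold trans
      simp only [Function.comp_apply]
      rw [mul_comm, L.coordChange_comp _ _ _ x ⟨⟨h1, h2⟩, h4⟩, mul_comm, L.coordChange_comp _ _ _ x ⟨⟨h1, h3⟩, h4⟩]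
    calc L.coordChange (W.frame (r (J 0))) (U.frame (J 0)) x * ((-1 : ℂ) ^ (j : ℕ) *
          (W.trans (r ∘ J) (Fin.succAbove j) x * (c ((r ∘ J) ∘ Fin.succAbove j) : M → ℂ) x))
        = (-1 : ℂ) ^ (j : ℕ) * ((L.coordChange (W.frame (r (J 0))) (U.frame (J 0)) x *
            W.trans (r ∘ J) (Fin.succAbove j) x) * (c ((r ∘ J) ∘ Fin.succAbove j) : M → ℂ) x) := by ring
      _ = (-1 : ℂ) ^ (j : ℕ) * (U.trans J (Fin.succAbove j) x *
            (L.coordChange (W.frame (r (J (Fin.succAbove j 0)))) (U.frame (J (Fin.succAbove j 0))) x *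
              (c ((r ∘ J) ∘ Fin.succAbove j) : M → ℂ) x)) := by rw [key]; ring
      _ = (-1 : ℂ) ^ (j : ℕ) * (U.trans J (Fin.succAbove j) x *
            (L.coordChange (W.frame (r (J (Fin.succAbove j 0)))) (U.frame (J (Fin.succAbove j 0))) x *
              (c (r ∘ J ∘ Fin.succAbove j) : M → ℂ) x)) := rfl
  · rw [holFunOn.apply_of_notMem _ hx, holFunOn.apply_of_notMem _ hx]

/-- **The refinement map on cohomology** `H^q(𝔚, 𝒪(L)) → H^q(𝔘, 𝒪(L))`. [cite: SerreFAC1955, n° 21] -/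
def refineH (q : ℕ) : W.cohomology q →ₗ[ℂ] U.cohomology q :=
  NatCochain.Cohomology.map (d := fun a ↦ W.delta a) (d' := fun a ↦ U.delta a) (fun a ↦ W.refineMap U r hr a)
    (fun a c ↦ W.refineMap_delta U r hr a c) q

/-! ### Injectivity in degree one -/

section Injective

variable (hcov : ∀ x : M, ∃ k, x ∈ U.U k)

open Classical in
/-- **The `0`-cochain of `𝔚` glued from a solution on the refinement**: on `W_i`,
`h_i(x) = g_{frame' k, frame i}(x) b_k(x) - c_{(i, r k)}(x)` for the chosen `U_k ∋ x` (independent of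
`k` for a cocycle `c` with `ρ c = δ b`, `refineGlue_apply_of_mem`); `0` off `W_i`.
[cite: Forster1981, Lemma 12.4] -/
def refineGlue (c : W.Cochain 1) (b : U.Cochain 0) (i : κ') : M → ℂ := fun x ↦
  if x ∈ W.U i then
    L.coordChange (U.frame (Classical.choose (hcov x))) (W.frame i) x * (b ![Classical.choose (hcov x)] : M → ℂ) x -
      (c ![i, r (Classical.choose (hcov x))] : M → ℂ) x
  else 0

/-- The glued cochain vanishes off `W_i`. [folklore] -/
theorem refineGlue_apply_of_notMem (c : W.Cochain 1) (b : U.Cochain 0) {i : κ'} {x : M} (hx : x ∉ W.U i) :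
    W.refineGlue U r hcov c b i x = 0 := by
  classical
  exact if_neg hx

/-- **The glued value does not depend on the member `U_k ∋ x` used** (the cocycle identity of `c` at
`(i, r k, r l)` and `ρ c = δ b` at `(k, l)`). [cite: Forster1981, Lemma 12.4] -/
theorem refineGlue_apply_of_mem {c : W.Cochain 1} (hc : W.delta 1 c = 0) {b : U.Cochain 0}
    (hb : W.refineMap U r hr 1 c = U.delta 0 b) {i : κ'} {k : κ} {x : M} (hxi : x ∈ W.U i) (hxk : x ∈ U.U k) :
    W.refineGlue U r hcov c b i x =
      L.coordChange (U.frame k) (W.frame i) x * (b ![k] : M → ℂ) x - (c ![i, r k] : M → ℂ) x := by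
  classical
  set l := Classical.choose (hcov x) with hl
  have hxl : x ∈ U.U l := Classical.choose_spec (hcov x)
  rw [refineGlue, if_pos hxi]
  change L.coordChange (U.frame l) (W.frame i) x * (b ![l] : M → ℂ) x - (c ![i, r l] : M → ℂ) x = _
  -- frames at `x`
  have hWi := W.subset i hxi
  have hWk := W.subset _ (hr k hxk)
  have hWl := W.subset _ (hr l hxl)
  have hUk := U.subset k hxk
  have hUl := U.subset l hxl
  -- cocycle of `c` at `(i, r k, r l)` and `ρ c = δ b` at `(k, l)`
  have h1 := W.delta_one_eq_zero_apply hc i (r k) (r l) ⟨⟨hxi, hr k hxk⟩, hr l hxl⟩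
  have h2 : L.coordChange (W.frame (r k)) (U.frame k) x * (c ![r k, r l] : M → ℂ) x =
      L.coordChange (U.frame l) (U.frame k) x * (b ![l] : M → ℂ) x - (b ![k] : M → ℂ) x := by
    have e := congr_fun (congr_arg Subtype.val (congr_fun hb ![k, l])) x
    have hxJ : x ∈ cechSet U.U ![k, l] := by
      rw [mem_cechSet_iff, Fin.forall_fin_two]; exact ⟨hxk, hxl⟩
    rw [W.refineMap_apply_apply_of_mem U r hr c hxJ, U.delta_zero_apply_apply b k l ⟨hxk, hxl⟩] at e
    have er : (r ∘ ![k, l] : Fin 2 → κ') = ![r k, r l] := by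
      funext j; fin_cases j <;> rfl
    rwa [show (c (r ∘ ![k, l]) : M → ℂ) x = (c ![r k, r l] : M → ℂ) x by rw [er]] at e
  have g1 : L.coordChange (U.frame k) (W.frame i) x * L.coordChange (W.frame (r k)) (U.frame k) x =
      L.coordChange (W.frame (r k)) (W.frame i) x := by
    rw [mul_comm]; exact L.coordChange_comp _ _ _ x ⟨⟨hWk, hUk⟩, hWi⟩
  have g2 : L.coordChange (U.frame k) (W.frame i) x * L.coordChange (U.frame l) (U.frame k) x =
      L.coordChange (U.frame l) (W.frame i) x := by
    rw [mul_comm]; exact L.coordChange_comp _ _ _ x ⟨⟨hUl, hUk⟩, hWi⟩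
  -- multiply `h2` by `g_{U k → W i}`
  have h3 := congrArg (fun t ↦ L.coordChange (U.frame k) (W.frame i) x * t) h2
  simp only [mul_sub, ← mul_assoc, g1, g2] at h3
  linear_combination h1 - h3

/-- The glued cochain is an element of `𝒪(W_i)` (locally `g b_k - c_{(i, r k)}`). [cite: Forster1981, Lemma 12.4] -/
theorem refineGlue_mem {c : W.Cochain 1} (hc : W.delta 1 c = 0) {b : U.Cochain 0}
    (hb : W.refineMap U r hr 1 c = U.delta 0 b) (i : κ') :
    W.refineGlue U r hcov c b i ∈ holFunOn E (cechSet W.U ![i]) := by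
  rw [cechSet_fin_one]
  refine ⟨fun x₀ hx₀ ↦ ?_, fun x hx ↦ W.refineGlue_apply_of_notMem U r hcov c b hx⟩
  obtain ⟨k, hk⟩ := hcov x₀
  set O : Set M := W.U i ∩ U.U k with hOdef
  have hO : IsOpen O := (W.isOpen i).inter (U.isOpen k)
  have hx₀O : x₀ ∈ O := ⟨hx₀, hk⟩
  have hF : MDifferentiableOn 𝓘(ℂ, E) 𝓘(ℂ, ℂ) (fun x ↦
      L.coordChange (U.frame k) (W.frame i) x * (b ![k] : M → ℂ) x - (c ![i, r k] : M → ℂ) x) O := by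
    refine (((L.mdifferentiableOn_coordChange _ _).mono fun x hx ↦ ⟨U.subset k hx.2, W.subset i hx.1⟩).mul
      ((holFunOn.mdifferentiableOn (b ![k])).mono fun x hx ↦ ?_)).sub
      ((holFunOn.mdifferentiableOn (c ![i, r k])).mono fun x hx ↦ ?_)
    · rw [cechSet_fin_one]; exact hx.2
    · rw [mem_cechSet_iff, Fin.forall_fin_two]; exact ⟨hx.1, hr k hx.2⟩
  have hev : W.refineGlue U r hcov c b i =ᶠ[𝓝 x₀] fun x ↦
      L.coordChange (U.frame k) (W.frame i) x * (b ![k] : M → ℂ) x - (c ![i, r k] : M → ℂ) x := by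
    filter_upwards [hO.mem_nhds hx₀O] with x hx
    exact W.refineGlue_apply_of_mem U r hr hcov hc hb hx.1 hx.2
  exact (((hF x₀ hx₀O).mdifferentiableAt (hO.mem_nhds hx₀O)).congr_of_eventuallyEq hev).mdifferentiableWithinAt

include hcov in
/-- **Injectivity lemma** (Serre FAC n° 22 Prop. 3; Forster Lemma 12.4): if the refinement of a
`1`-cocycle `c` of `𝔚` is a coboundary on a covering `𝔘`, then `c` is a coboundary on `𝔚`.
[cite: SerreFAC1955, n° 22 Prop. 3] -/
theorem exists_delta_eq_of_refineMap_eq_delta {c : W.Cochain 1} (hc : W.delta 1 c = 0) {b : U.Cochain 0}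
    (hb : W.refineMap U r hr 1 c = U.delta 0 b) : ∃ h : W.Cochain 0, W.delta 0 h = c := by
  refine ⟨fun J ↦ ⟨W.refineGlue U r hcov c b (J 0), by
    have e : J = ![J 0] := by funext j; fin_cases j; rfl
    rw [e]; exact W.refineGlue_mem U r hr hcov hc hb (J 0)⟩, ?_⟩
  funext J
  refine Subtype.ext (funext fun x ↦ ?_)
  by_cases hx : x ∈ cechSet W.U J
  · have hx0 : x ∈ W.U (J 0) := cechSet_subset_apply W.U J 0 hx
    have hx1 : x ∈ W.U (J 1) := cechSet_subset_apply W.U J 1 hx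
    obtain ⟨k, hk⟩ := hcov x
    have hJ : J = ![J 0, J 1] := by funext j; fin_cases j <;> rfl
    have hd := W.delta_zero_apply_apply (fun J ↦ (⟨W.refineGlue U r hcov c b (J 0), by
      have e : J = ![J 0] := by funext j; fin_cases j; rfl
      rw [e]; exact W.refineGlue_mem U r hr hcov hc hb (J 0)⟩ : holFunOn E (cechSet W.U J))) (J 0) (J 1) ⟨hx0, hx1⟩
    rw [← hJ] at hd
    rw [hd]
    change L.coordChange (W.frame (J 1)) (W.frame (J 0)) x * W.refineGlue U r hcov c b (J 1) x -
      W.refineGlue U r hcov c b (J 0) x = _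
    rw [W.refineGlue_apply_of_mem U r hr hcov hc hb hx1 hk, W.refineGlue_apply_of_mem U r hr hcov hc hb hx0 hk]
    -- cocycle of `c` at `(J 0, J 1, r k)` and of `g`
    have h1 := W.delta_one_eq_zero_apply hc (J 0) (J 1) (r k) ⟨⟨hx0, hx1⟩, hr k hk⟩
    have hW0 := W.subset _ hx0
    have hW1 := W.subset _ hx1
    have hUk := U.subset k hk
    have g1 : L.coordChange (W.frame (J 1)) (W.frame (J 0)) x * L.coordChange (U.frame k) (W.frame (J 1)) x =
        L.coordChange (U.frame k) (W.frame (J 0)) x := by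
      rw [mul_comm]; exact L.coordChange_comp _ _ _ x ⟨⟨hUk, hW1⟩, hW0⟩
    have hcJ : (c J : M → ℂ) x = (c ![J 0, J 1] : M → ℂ) x := by rw [← hJ]
    rw [hcJ]
    linear_combination (b ![k] : M → ℂ) x * g1 - h1
  · rw [holFunOn.apply_of_notMem _ hx, holFunOn.apply_of_notMem _ hx]

include hcov in
/-- **`H¹(𝔚, 𝒪(L)) → H¹(𝔘, 𝒪(L))` is injective** for a refinement by a covering `𝔘`.
[cite: SerreFAC1955, n° 22 Prop. 3] -/
theorem injective_refineH_one : Injective (W.refineH U r hr 1) := by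
  refine (injective_iff_map_eq_zero _).2 fun γ hγ ↦ ?_
  obtain ⟨z, rfl⟩ := NatCochain.Cohomology.mk_surjective (R := ℂ) (fun a ↦ W.delta a) 1 γ
  have hz : W.delta 1 (z : W.Cochain 1) = 0 := (NatCochain.mem_cocycles_iff _).1 z.2
  have hγ' : (W.refineMap U r hr 1 z : U.Cochain 1) ∈ NatCochain.coboundaries (R := ℂ) (fun a ↦ U.delta a) 1 := by
    have e : W.refineH U r hr 1 (NatCochain.Cohomology.mk _ 1 z) =
        NatCochain.Cohomology.mk _ 1 (NatCochain.Cohomology.mapCocycles (fun a ↦ W.refineMap U r hr a)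
          (fun a c ↦ W.refineMap_delta U r hr a c) 1 z) := NatCochain.Cohomology.map_mk _ _ z
    rw [hγ] at e
    exact (NatCochain.Cohomology.mk_eq_zero_iff _ _).1 e.symm
  obtain ⟨b, hb⟩ := (NatCochain.mem_coboundaries_succ_iff _).1 hγ'
  obtain ⟨h, hh⟩ := W.exists_delta_eq_of_refineMap_eq_delta U r hr hcov hz hb.symm
  exact (NatCochain.Cohomology.mk_eq_zero_iff _ _).2 ((NatCochain.mem_coboundaries_succ_iff _).2 ⟨h, hh⟩)

end Injective

/-! ### Finiteness of `H¹(𝔚, 𝒪(L))` on compact complex manifolds -/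

/-- **`dim H¹(𝔚, 𝒪(L)) < ∞` for EVERY covering framed cover of a cocycle line bundle on a compact
complex manifold** (Cartan–Serre): refine `𝔚` by the level-`0` cover of nested Leray data subordinate
to `L` and to `𝔚` (`HolomorphicLineBundle.exists_finite_cohomology_one`) and use the injectivity of
`H¹` under refinement. [cite: CartanSerre1953] -/
theorem finite_cohomology_one [FiniteDimensional ℂ E] [T2Space M] [CompactSpace M] [IsManifold 𝓘(ℂ, E) ω M]
    [IsManifold 𝓘(ℝ, E) ∞ M] (hWcov : ∀ x : M, ∃ i, x ∈ W.U i) : Module.Finite ℂ (W.cohomology 1) := by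
  choose iW hiW using hWcov
  obtain ⟨D, fr, hfr, hsub, hfin⟩ := L.exists_finite_cohomology_one
    (OpenNhdFamily.ofCover W.U W.isOpen iW hiW)
  choose xsub hxsub using hsub
  -- the level-`0` cover refines `𝔚`
  set r : ↥D.s → κ' := fun i ↦ iW (xsub i) with hrdef
  have hr : ∀ i, (D.framedCover fr hfr 0).U i ⊆ W.U (r i) := fun i ↦
    (D.mono 0 3 (by decide) i).trans (hxsub i)
  haveI := hfin
  exact Module.Finite.of_injective (W.refineH (D.framedCover fr hfr 0) r hr 1)
    (W.injective_refineH_one (D.framedCover fr hfr 0) r hr (D.exists_mem_U 0))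

end FramedCover

end HolomorphicLineBundle

end Literature.Geometry.Kaehler
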